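import Mathlib
import Summits.NavierStokesRegularity.NavierStokesRegularity.Theorems.TaoLadderRungTwoFlatGappedFrontRobustTailStepOn
import Summits.NavierStokesRegularity.NavierStokesRegularity.Theorems.TaoLadderRungThreeGappedFrontRobustTailStart
import HarnessLib

/-!
# Shift-set pseudo-flows `PseudoFlowOnShift 𝕊`: THE TAIL ZONE with backscatter (helper for item
  stmt-NavierStokesRegularity-22988 `GappedFrontRobustV2Flat`, crux K_B♭ of route TaoLadderRungTwoFlat)

The `𝕊`-parametrised version of `Theorems/TaoLadderRungThreeGappedFrontRobustTailZone.lean` (p1 g9, one-way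
`S`): along ANY pseudo-flow on a nearest-neighbour slot-closed shift set without the class `(1,1,1)`
(e.g. `S`, `S♭`), the tail clauses (T1) `2(1+ε₀)^k w k ≤ w (k+1)`, (T2) `4 w k |z_{i,k}| ≤ r` (from `k₁`),
a ball start `w k |S₀ − z| ≤ r`, a tail slack `B₀ ≤ β (1+ε₀)^{2k} r²/w k²`, the THIN TAIL
`(1+ε₀)^{5K/2} r w(K−1) ≤ ϑ w(K−2)²` (from `k₂`), the base bound `|S_{i,k₂−1}| ≤ ν(k₂−1) r / w(k₂−2)`,
the scalar CLOSING CONDITION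
`2 · ( √2·√((4/3) m (25/32 + β q^{2K})) / (2 q^{K−1}) + C τ (ϑ/q^{5/2}) ν(K−1)² ) ≤ ν(K)` and the
SLOWNESS CONDITION `(1+ε₀)^{5(K−1)/2} C τ ν(K−1) r / w(K−2) ≤ 1/2` (`K ≥ k₂`, `C = ∑_{botShifts 𝕊}|α|`)
give `|S_{i,K}(u)| ≤ ν(K) · r / w(K−1)` for every `K ≥ k₂ − 1` on `[0, τ]`
(`pseudoFlowOnShift_tail_zone`; energy form `pseudoFlowOnShift_tail_zone_energy`). Compared with `S`,
the closing condition carries the factor `2 ≥ exp(1/2)` bounding the backscatter exponential of the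
tail step (`pseudoFlowOnShift_tail_induction`), and the slowness condition is what makes that
exponential `≤ exp(1/2)`; both extra requirements are met far ahead of the front because
`(1+ε₀)^{5k/2} / w k → 0` under (T1) (`GappedFrontRobust.exists_top_shell`). The closing condition
is the `S` one with `(m, C)` replaced by `(4m, 2C)`, so `GappedFrontRobust.exists_tail_closing`
discharges it verbatim.

HONEST FRAMING: elementary real-analysis lemmas about Tao-type MODEL lattice pseudo-flows (Tao 2016 §4
(4.5), (4.9)–(4.10) with (4.3), §6.2 Prop. 6.3 (ix)) on a general nearest-neighbour shift set; nothing
here is a statement about the Navier–Stokes equations, and nothing is asserted about any table (p1 g12).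
-/

noncomputable section

-- the sub-problem namespace `Summit.NavierStokesRegularity.NavierStokesRegularity` repeats the summit name by design (D-0017)
set_option linter.dupNamespace false

namespace Summit.NavierStokesRegularity.NavierStokesRegularity.Theorems

open Set MeasureTheory intervalIntegral Literature.Analysis.FluidPDE Literature.Analysis.FluidPDE.TaoCascade

namespace GappedFrontRobustOn

variable {m : ℕ} {𝕊 : Finset (ℤ × ℤ × ℤ)}
variable {τ ε₀ : ℝ} {α : Fin m → Fin m → Fin m → ℤ × ℤ × ℤ → ℝ} {κ₁ κ₂ : ℝ}
  {S₀ F₀ B₀ : Fin m → ℤ → ℝ} {S F : Fin m → ℤ → ℝ → ℝ}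

/-- **THE TAIL ZONE on `𝕊`.** See the module docstring. [cite: Tao2016AveragedNS, §4 Lemma 4.1 (4.5), (4.9)–(4.10) with (4.3) and §6.2 Prop. 6.3 (ix)] -/
theorem pseudoFlowOnShift_tail_zone (h𝕊 : IsNearestNeighbourSet 𝕊) (h𝕊c : IsSlotClosed 𝕊)
    (h111 : ((1 : ℤ), (1 : ℤ), (1 : ℤ)) ∉ 𝕊) (h : PseudoFlowOnShift 𝕊 τ ε₀ α κ₁ κ₂ S₀ F₀ B₀ S F)
    (hτ : 0 < τ) (hε : 0 < ε₀) (hα : IsCancellingCoeffOn 𝕊 α) {w : ℤ → ℝ} {z : Fin m → ℤ → ℝ}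
    {r β ϑ : ℝ} {k₁ k₂ : ℤ} {ν : ℤ → ℝ} (hr : 0 ≤ r) (hβ : 0 ≤ β) (hw : ∀ k, 0 < w k)
    (hT1 : ∀ k : ℤ, k₁ ≤ k → 2 * (1 + ε₀) ^ (k : ℝ) * w k ≤ w (k + 1))
    (hT2 : ∀ k : ℤ, k₁ ≤ k → ∀ i, 4 * (w k * |z i k|) ≤ r)
    (hball : ∀ i k, w k * |S₀ i k - z i k| ≤ r)
    (hB₀ : ∀ i k, k₁ ≤ k → B₀ i k ≤ β * (1 + ε₀) ^ ((2 : ℝ) * k) * r ^ 2 / w k ^ 2)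
    (hthin : ∀ K : ℤ, k₂ ≤ K →
      (1 + ε₀) ^ ((5 : ℝ) * K / 2) * r * w (K - 1) ≤ ϑ * w (K - 2) ^ 2)
    (hk₂ : k₁ + 1 ≤ k₂) (hk₂' : 2 ≤ k₂) (hν : ∀ K : ℤ, k₂ - 1 ≤ K → 0 ≤ ν K)
    (hclose : ∀ K : ℤ, k₂ ≤ K →
      2 * (Real.sqrt 2 * Real.sqrt (4 / 3 * m * (25 / 32 + β * (1 + ε₀) ^ ((2 : ℝ) * K))) /
          (2 * (1 + ε₀) ^ ((K - 1 : ℤ) : ℝ)) +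
        coeffAbsOn (botShifts 𝕊) α * τ * (ϑ / (1 + ε₀) ^ ((5 : ℝ) / 2)) * ν (K - 1) ^ 2) ≤ ν K)
    (hslow : ∀ K : ℤ, k₂ ≤ K →
      (1 + ε₀) ^ ((5 : ℝ) * (K - 1 : ℤ) / 2) * coeffAbsOn (botShifts 𝕊) α * τ *
        (ν (K - 1) * r / w (K - 2)) ≤ 1 / 2)
    (hbase : ∀ u ∈ Icc 0 τ, ∀ i, |S i (k₂ - 1) u| ≤ ν (k₂ - 1) * r / w (k₂ - 2)) :
    ∀ K : ℤ, k₂ - 1 ≤ K → ∀ u ∈ Icc 0 τ, ∀ i, |S i K u| ≤ ν K * r / w (K - 1) := by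
  have hq : 0 < 1 + ε₀ := by linarith
  have hq1 : 1 ≤ 1 + ε₀ := by linarith
  set C : ℝ := coeffAbsOn (botShifts 𝕊) α with hC
  have hC0 : 0 ≤ C := coeffAbsOn_nonneg _ _
  -- start energies: F₀ ≤ ½S₀² + B₀ from (4.10) at time 0
  have hF₀ : ∀ i k, F₀ i k ≤ (1 / 2) * S₀ i k ^ 2 + B₀ i k := by
    intro i k
    have h0 : (0 : ℝ) ∈ Icc 0 τ := ⟨le_rfl, hτ.le⟩
    have := h.defect_upper i k 0 h0
    rw [h.init_F i k, h.init_S i k, intervalIntegral.integral_same, mul_zero, add_zero] at this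
    exact this
  -- the tail induction with E K := (4/3) m (25/32 + β q^{2K}) r²/w_K², P K := ν K · r / w(K-1)
  set E : ℤ → ℝ := fun K => 4 / 3 * m * ((25 / 32 + β * (1 + ε₀) ^ ((2 : ℝ) * K)) * r ^ 2 / w K ^ 2)
    with hE
  set P : ℤ → ℝ := fun K => ν K * r / w (K - 1) with hP
  have hE0 : ∀ K : ℤ, k₂ ≤ K → 0 ≤ E K := fun K _ => by
    have := hw K; have := Real.rpow_pos_of_pos hq ((2 : ℝ) * K); positivity
  have hP0 : ∀ K : ℤ, k₂ - 1 ≤ K → 0 ≤ P K := fun K hK => by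
    have := hw (K - 1); have := hν K hK; positivity
  have hEsum : ∀ K : ℤ, k₂ ≤ K → ∀ L : ℕ, ∑ k ∈ Finset.range L, ∑ i, F₀ i (K + k) ≤ E K :=
    fun K hK L => GappedFrontRobust.tail_start_energy_le hε.le hβ hw hT1 hT2 hball hF₀ hB₀
      (by linarith) (by linarith) L
  have hrec : ∀ K : ℤ, k₂ ≤ K →
      Real.sqrt 2 * ((Real.sqrt (E K) + Real.sqrt 2 / 2 * (1 + ε₀) ^ ((5 : ℝ) * (K - 1 : ℤ) / 2) *
          C * P (K - 1) ^ 2 * τ) *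
        Real.exp ((1 + ε₀) ^ ((5 : ℝ) * (K - 1 : ℤ) / 2) * C * P (K - 1) * τ)) ≤ P K := by
    intro K hK
    have hwK := hw K
    have hwK1 := hw (K - 1)
    have hwK2 := hw (K - 2)
    have hνK1 := hν (K - 1) (by linarith)
    set Λ : ℝ := (1 + ε₀) ^ ((5 : ℝ) * (K - 1 : ℤ) / 2) with hΛ
    have hΛ0 : 0 ≤ Λ := (Real.rpow_pos_of_pos hq _).le
    -- √(E K) = √a · r / w K with a := (4/3) m (25/32 + β q^{2K})
    set a : ℝ := 4 / 3 * m * (25 / 32 + β * (1 + ε₀) ^ ((2 : ℝ) * K)) with ha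
    have ha0 : 0 ≤ a := by have := Real.rpow_pos_of_pos hq ((2 : ℝ) * K); positivity
    have hsqrtE : Real.sqrt (E K) = Real.sqrt a * (r / w K) := by
      have : E K = a * (r / w K) ^ 2 := by simp only [hE, ha]; field_simp
      rw [this, Real.sqrt_mul ha0, Real.sqrt_sq (div_nonneg hr hwK.le)]
    -- (T1) at K-1: r / w K ≤ r / (2 q^{K-1} w(K-1))
    have hT := hT1 (K - 1) (by linarith)
    rw [sub_add_cancel] at hT
    have hqK1 : 0 < (1 + ε₀) ^ ((K - 1 : ℤ) : ℝ) := Real.rpow_pos_of_pos hq _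
    have hrw : r / w K ≤ r / (2 * (1 + ε₀) ^ ((K - 1 : ℤ) : ℝ) * w (K - 1)) :=
      div_le_div_of_nonneg_left hr (by positivity) hT
    -- the thin tail: q^{5(K-1)/2} r / w(K-2)² ≤ ϑ / (q^{5/2} w(K-1))
    have hΛ' : Λ * r / w (K - 2) ^ 2 ≤ ϑ / ((1 + ε₀) ^ ((5 : ℝ) / 2) * w (K - 1)) := by
      rw [div_le_div_iff₀ (pow_pos hwK2 2) (by positivity)]
      have hsplit : Λ * (1 + ε₀) ^ ((5 : ℝ) / 2) = (1 + ε₀) ^ ((5 : ℝ) * K / 2) := by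
        rw [hΛ, ← Real.rpow_add hq]; push_cast; ring_nf
      calc Λ * r * ((1 + ε₀) ^ ((5 : ℝ) / 2) * w (K - 1))
          = (Λ * (1 + ε₀) ^ ((5 : ℝ) / 2)) * r * w (K - 1) := by ring
        _ = (1 + ε₀) ^ ((5 : ℝ) * K / 2) * r * w (K - 1) := by rw [hsplit]
        _ ≤ ϑ * w (K - 2) ^ 2 := hthin K hK
    -- the pumping term
    have hpump : Λ * C * (τ * P (K - 1) ^ 2) ≤
        C * τ * (ϑ / (1 + ε₀) ^ ((5 : ℝ) / 2)) * ν (K - 1) ^ 2 * (r / w (K - 1)) := by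
      have hKK : K - 1 - 1 = K - 2 := by ring
      simp only [hP, hKK]
      have hrr : 0 ≤ ν (K - 1) ^ 2 * r := mul_nonneg (sq_nonneg _) hr
      calc Λ * C * (τ * (ν (K - 1) * r / w (K - 2)) ^ 2)
          = C * τ * (ν (K - 1) ^ 2 * r) * (Λ * r / w (K - 2) ^ 2) := by
            field_simp
        _ ≤ C * τ * (ν (K - 1) ^ 2 * r) * (ϑ / ((1 + ε₀) ^ ((5 : ℝ) / 2) * w (K - 1))) :=
            mul_le_mul_of_nonneg_left hΛ' (by positivity)
        _ = C * τ * (ϑ / (1 + ε₀) ^ ((5 : ℝ) / 2)) * ν (K - 1) ^ 2 * (r / w (K - 1)) := by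
            field_simp
    -- the backscatter exponential ≤ 2
    have hexp : Real.exp (Λ * C * P (K - 1) * τ) ≤ 2 := by
      have hKK : K - 1 - 1 = K - 2 := by ring
      have h1 : Λ * C * P (K - 1) * τ ≤ 1 / 2 := by
        have := hslow K hK
        simp only [hP, hKK]
        calc Λ * C * (ν (K - 1) * r / w (K - 2)) * τ = Λ * C * τ * (ν (K - 1) * r / w (K - 2)) := by
              ring
          _ ≤ 1 / 2 := this
      have hexp2 : Real.exp (1 / 2) ≤ 2 := by
        have h1 : (1 : ℝ) / 2 ≤ Real.exp (-(1 / 2)) := by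
          have := Real.add_one_le_exp (-(1 / 2 : ℝ)); linarith
        have h2 : Real.exp (1 / 2) = (Real.exp (-(1 / 2)))⁻¹ := by
          rw [Real.exp_neg, inv_inv]
        rw [h2, inv_le_comm₀ (Real.exp_pos _) (by norm_num)]
        simpa using h1
      exact (Real.exp_le_exp.mpr h1).trans hexp2
    -- assemble with the closing condition
    have hcl := hclose K hK
    have hrw1 : 0 ≤ r / w (K - 1) := div_nonneg hr hwK1.le
    have hs2 : 0 ≤ Real.sqrt 2 := Real.sqrt_nonneg 2
    have hsa : 0 ≤ Real.sqrt a := Real.sqrt_nonneg a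
    have hPK1 : 0 ≤ P (K - 1) := hP0 (K - 1) (by linarith)
    have hinner : Real.sqrt 2 * (Real.sqrt (E K) + Real.sqrt 2 / 2 * Λ * C * P (K - 1) ^ 2 * τ) ≤
        (Real.sqrt 2 * Real.sqrt a / (2 * (1 + ε₀) ^ ((K - 1 : ℤ) : ℝ)) +
          C * τ * (ϑ / (1 + ε₀) ^ ((5 : ℝ) / 2)) * ν (K - 1) ^ 2) * (r / w (K - 1)) := by
      calc Real.sqrt 2 * (Real.sqrt (E K) + Real.sqrt 2 / 2 * Λ * C * P (K - 1) ^ 2 * τ)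
          = Real.sqrt 2 * Real.sqrt (E K) + Λ * C * (τ * P (K - 1) ^ 2) := by
            have : Real.sqrt 2 * Real.sqrt 2 = 2 := Real.mul_self_sqrt (by norm_num)
            linear_combination (Λ * C * (τ * P (K - 1) ^ 2)) / 2 * this
        _ ≤ Real.sqrt 2 * (Real.sqrt a * (r / (2 * (1 + ε₀) ^ ((K - 1 : ℤ) : ℝ) * w (K - 1)))) +
              C * τ * (ϑ / (1 + ε₀) ^ ((5 : ℝ) / 2)) * ν (K - 1) ^ 2 * (r / w (K - 1)) := by
            rw [hsqrtE]
            gcongr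
        _ = (Real.sqrt 2 * Real.sqrt a / (2 * (1 + ε₀) ^ ((K - 1 : ℤ) : ℝ)) +
              C * τ * (ϑ / (1 + ε₀) ^ ((5 : ℝ) / 2)) * ν (K - 1) ^ 2) * (r / w (K - 1)) := by
            field_simp
    have hinner0 : 0 ≤ Real.sqrt 2 * (Real.sqrt (E K) + Real.sqrt 2 / 2 * Λ * C * P (K - 1) ^ 2 * τ) := by
      have := hE0 K hK; positivity
    calc Real.sqrt 2 * ((Real.sqrt (E K) + Real.sqrt 2 / 2 * Λ * C * P (K - 1) ^ 2 * τ) *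
          Real.exp (Λ * C * P (K - 1) * τ))
        = Real.sqrt 2 * (Real.sqrt (E K) + Real.sqrt 2 / 2 * Λ * C * P (K - 1) ^ 2 * τ) *
            Real.exp (Λ * C * P (K - 1) * τ) := by ring
      _ ≤ ((Real.sqrt 2 * Real.sqrt a / (2 * (1 + ε₀) ^ ((K - 1 : ℤ) : ℝ)) +
            C * τ * (ϑ / (1 + ε₀) ^ ((5 : ℝ) / 2)) * ν (K - 1) ^ 2) * (r / w (K - 1))) * 2 :=
          mul_le_mul hinner hexp (Real.exp_pos _).le (hinner0.trans hinner)
      _ = 2 * (Real.sqrt 2 * Real.sqrt a / (2 * (1 + ε₀) ^ ((K - 1 : ℤ) : ℝ)) +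
            C * τ * (ϑ / (1 + ε₀) ^ ((5 : ℝ) / 2)) * ν (K - 1) ^ 2) * (r / w (K - 1)) := by ring
      _ ≤ ν K * (r / w (K - 1)) := mul_le_mul_of_nonneg_right hcl hrw1
      _ = P K := by simp only [hP]; ring
  have hbase' : ∀ u ∈ Icc 0 τ, ∀ i, |S i (k₂ - 1) u| ≤ P (k₂ - 1) := by
    intro u hu i
    have hKK : k₂ - 1 - 1 = k₂ - 2 := by ring
    simp only [hP, hKK]
    exact hbase u hu i
  intro K hK u hu i
  have := pseudoFlowOnShift_tail_induction h𝕊 h𝕊c h111 h hτ hε hα k₂ hE0 hP0 hEsum hrec hbase' K hK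
    u hu i
  simpa only [hP] using this

/-- **THE TAIL ZONE on `𝕊`, energy form**: under the hypotheses of `pseudoFlowOnShift_tail_zone`, every
tail shell `K ≥ k₂` also satisfies `∑_i F_{i,K}(u) ≤ (ν K · r / w(K−1))² / 2` on `[0, τ]` — the form
consumed by the epoch-envelope clause `F ≤ env` with the tail envelope `env K ≍ r²/w(K−1)²`.
[cite: Tao2016AveragedNS, §4 Lemma 4.1 (4.5), (4.9)–(4.10) with (4.3) and §6.2 Prop. 6.3 (ix)] -/
theorem pseudoFlowOnShift_tail_zone_energy (h𝕊 : IsNearestNeighbourSet 𝕊) (h𝕊c : IsSlotClosed 𝕊)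
    (h111 : ((1 : ℤ), (1 : ℤ), (1 : ℤ)) ∉ 𝕊) (h : PseudoFlowOnShift 𝕊 τ ε₀ α κ₁ κ₂ S₀ F₀ B₀ S F)
    (hτ : 0 < τ) (hε : 0 < ε₀) (hα : IsCancellingCoeffOn 𝕊 α) {w : ℤ → ℝ} {z : Fin m → ℤ → ℝ}
    {r β ϑ : ℝ} {k₁ k₂ : ℤ} {ν : ℤ → ℝ} (hr : 0 ≤ r) (hβ : 0 ≤ β) (hw : ∀ k, 0 < w k)
    (hT1 : ∀ k : ℤ, k₁ ≤ k → 2 * (1 + ε₀) ^ (k : ℝ) * w k ≤ w (k + 1))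
    (hT2 : ∀ k : ℤ, k₁ ≤ k → ∀ i, 4 * (w k * |z i k|) ≤ r)
    (hball : ∀ i k, w k * |S₀ i k - z i k| ≤ r)
    (hB₀ : ∀ i k, k₁ ≤ k → B₀ i k ≤ β * (1 + ε₀) ^ ((2 : ℝ) * k) * r ^ 2 / w k ^ 2)
    (hthin : ∀ K : ℤ, k₂ ≤ K →
      (1 + ε₀) ^ ((5 : ℝ) * K / 2) * r * w (K - 1) ≤ ϑ * w (K - 2) ^ 2)
    (hk₂ : k₁ + 1 ≤ k₂) (hk₂' : 2 ≤ k₂) (hν : ∀ K : ℤ, k₂ - 1 ≤ K → 0 ≤ ν K)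
    (hclose : ∀ K : ℤ, k₂ ≤ K →
      2 * (Real.sqrt 2 * Real.sqrt (4 / 3 * m * (25 / 32 + β * (1 + ε₀) ^ ((2 : ℝ) * K))) /
          (2 * (1 + ε₀) ^ ((K - 1 : ℤ) : ℝ)) +
        coeffAbsOn (botShifts 𝕊) α * τ * (ϑ / (1 + ε₀) ^ ((5 : ℝ) / 2)) * ν (K - 1) ^ 2) ≤ ν K)
    (hslow : ∀ K : ℤ, k₂ ≤ K →
      (1 + ε₀) ^ ((5 : ℝ) * (K - 1 : ℤ) / 2) * coeffAbsOn (botShifts 𝕊) α * τ *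
        (ν (K - 1) * r / w (K - 2)) ≤ 1 / 2)
    (hbase : ∀ u ∈ Icc 0 τ, ∀ i, |S i (k₂ - 1) u| ≤ ν (k₂ - 1) * r / w (k₂ - 2))
    {K : ℤ} (hK : k₂ ≤ K) {u : ℝ} (hu : u ∈ Icc 0 τ) :
    ∑ i, F i K u ≤ (ν K * r / w (K - 1)) ^ 2 / 2 := by
  have hq : 0 < 1 + ε₀ := by linarith
  set C : ℝ := coeffAbsOn (botShifts 𝕊) α with hC
  have hC0 : 0 ≤ C := coeffAbsOn_nonneg _ _
  have hwK := hw K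
  have hwK1 := hw (K - 1)
  have hwK2 := hw (K - 2)
  have hνK1 := hν (K - 1) (by linarith)
  set Λ : ℝ := (1 + ε₀) ^ ((5 : ℝ) * (K - 1 : ℤ) / 2) with hΛ
  have hΛ0 : 0 ≤ Λ := (Real.rpow_pos_of_pos hq _).le
  -- amplitude bound on shell K-1 from the tail zone
  have hamp := pseudoFlowOnShift_tail_zone h𝕊 h𝕊c h111 h hτ hε hα hr hβ hw hT1 hT2 hball hB₀ hthin hk₂
    hk₂' hν hclose hslow hbase (K - 1) (by linarith)
  have hKK : K - 1 - 1 = K - 2 := by ring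
  rw [hKK] at hamp
  set Pc : ℝ := ν (K - 1) * r / w (K - 2) with hPc
  have hPc0 : 0 ≤ Pc := by positivity
  -- start energies
  have hF₀ : ∀ i k, F₀ i k ≤ (1 / 2) * S₀ i k ^ 2 + B₀ i k := by
    intro i k
    have h0 : (0 : ℝ) ∈ Icc 0 τ := ⟨le_rfl, hτ.le⟩
    have := h.defect_upper i k 0 h0
    rw [h.init_F i k, h.init_S i k, intervalIntegral.integral_same, mul_zero, add_zero] at this
    exact this
  set a : ℝ := 4 / 3 * m * (25 / 32 + β * (1 + ε₀) ^ ((2 : ℝ) * K)) with ha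
  have ha0 : 0 ≤ a := by have := Real.rpow_pos_of_pos hq ((2 : ℝ) * K); positivity
  set E₀ : ℝ := 4 / 3 * m * ((25 / 32 + β * (1 + ε₀) ^ ((2 : ℝ) * K)) * r ^ 2 / w K ^ 2) with hE₀
  have hE₀0 : 0 ≤ E₀ := by have := Real.rpow_pos_of_pos hq ((2 : ℝ) * K); positivity
  have hEsum : ∀ L : ℕ, ∑ k ∈ Finset.range L, ∑ i, F₀ i (K + k) ≤ E₀ := fun L =>
    GappedFrontRobust.tail_start_energy_le hε.le hβ hw hT1 hT2 hball hF₀ hB₀ (by linarith)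
      (by linarith) L
  -- the energy form of the one-directional step with the constant bound on shell K-1
  have hstep := pseudoFlowOnShift_sqrt_shell_energy_le_tail h𝕊 h𝕊c h111 h hτ hε hα K hE₀0 hEsum hPc0
    hamp hu
  -- the same algebra as in the tail zone
  have hsqrtE : Real.sqrt E₀ = Real.sqrt a * (r / w K) := by
    have : E₀ = a * (r / w K) ^ 2 := by simp only [hE₀, ha]; ring
    rw [this, Real.sqrt_mul ha0, Real.sqrt_sq (div_nonneg hr hwK.le)]
  have hT := hT1 (K - 1) (by linarith)
  rw [sub_add_cancel] at hT
  have hqK1 : 0 < (1 + ε₀) ^ ((K - 1 : ℤ) : ℝ) := Real.rpow_pos_of_pos hq _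
  have hrw : r / w K ≤ r / (2 * (1 + ε₀) ^ ((K - 1 : ℤ) : ℝ) * w (K - 1)) :=
    div_le_div_of_nonneg_left hr (by positivity) hT
  have hΛ' : Λ * r / w (K - 2) ^ 2 ≤ ϑ / ((1 + ε₀) ^ ((5 : ℝ) / 2) * w (K - 1)) := by
    rw [div_le_div_iff₀ (pow_pos hwK2 2) (by positivity)]
    have hsplit : Λ * (1 + ε₀) ^ ((5 : ℝ) / 2) = (1 + ε₀) ^ ((5 : ℝ) * K / 2) := by
      rw [hΛ, ← Real.rpow_add hq]; push_cast; ring_nf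
    calc Λ * r * ((1 + ε₀) ^ ((5 : ℝ) / 2) * w (K - 1))
        = (Λ * (1 + ε₀) ^ ((5 : ℝ) / 2)) * r * w (K - 1) := by ring
      _ = (1 + ε₀) ^ ((5 : ℝ) * K / 2) * r * w (K - 1) := by rw [hsplit]
      _ ≤ ϑ * w (K - 2) ^ 2 := hthin K hK
  have hpump : Λ * C * Pc ^ 2 * u ≤
      C * τ * (ϑ / (1 + ε₀) ^ ((5 : ℝ) / 2)) * ν (K - 1) ^ 2 * (r / w (K - 1)) := by
    have hrr : 0 ≤ ν (K - 1) ^ 2 * r := mul_nonneg (sq_nonneg _) hr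
    calc Λ * C * Pc ^ 2 * u ≤ Λ * C * Pc ^ 2 * τ :=
          mul_le_mul_of_nonneg_left hu.2 (by positivity)
      _ = C * τ * (ν (K - 1) ^ 2 * r) * (Λ * r / w (K - 2) ^ 2) := by
          simp only [hPc]; field_simp
      _ ≤ C * τ * (ν (K - 1) ^ 2 * r) * (ϑ / ((1 + ε₀) ^ ((5 : ℝ) / 2) * w (K - 1))) :=
          mul_le_mul_of_nonneg_left hΛ' (by positivity)
      _ = C * τ * (ϑ / (1 + ε₀) ^ ((5 : ℝ) / 2)) * ν (K - 1) ^ 2 * (r / w (K - 1)) := by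
          field_simp
  have hexp : Real.exp (Λ * C * Pc * u) ≤ 2 := by
    have h1 : Λ * C * Pc * u ≤ 1 / 2 := by
      have := hslow K hK
      calc Λ * C * Pc * u ≤ Λ * C * Pc * τ := mul_le_mul_of_nonneg_left hu.2 (by positivity)
        _ = Λ * C * τ * Pc := by ring
        _ ≤ 1 / 2 := this
    have hexp2 : Real.exp (1 / 2) ≤ 2 := by
      have h1 : (1 : ℝ) / 2 ≤ Real.exp (-(1 / 2)) := by
        have := Real.add_one_le_exp (-(1 / 2 : ℝ)); linarith
      have h2 : Real.exp (1 / 2) = (Real.exp (-(1 / 2)))⁻¹ := by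
        rw [Real.exp_neg, inv_inv]
      rw [h2, inv_le_comm₀ (Real.exp_pos _) (by norm_num)]
      simpa using h1
    exact (Real.exp_le_exp.mpr h1).trans hexp2
  have hcl := hclose K hK
  have hrw1 : 0 ≤ r / w (K - 1) := div_nonneg hr hwK1.le
  have hs2 : 0 ≤ Real.sqrt 2 := Real.sqrt_nonneg 2
  have hsa : 0 ≤ Real.sqrt a := Real.sqrt_nonneg a
  -- √2 · √(Σ F) ≤ ν K · r / w(K-1)
  have hinner : Real.sqrt 2 * (Real.sqrt E₀ + Real.sqrt 2 / 2 * Λ * C * Pc ^ 2 * u) ≤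
      (Real.sqrt 2 * Real.sqrt a / (2 * (1 + ε₀) ^ ((K - 1 : ℤ) : ℝ)) +
        C * τ * (ϑ / (1 + ε₀) ^ ((5 : ℝ) / 2)) * ν (K - 1) ^ 2) * (r / w (K - 1)) := by
    calc Real.sqrt 2 * (Real.sqrt E₀ + Real.sqrt 2 / 2 * Λ * C * Pc ^ 2 * u)
        = Real.sqrt 2 * Real.sqrt E₀ + Λ * C * Pc ^ 2 * u := by
          have : Real.sqrt 2 * Real.sqrt 2 = 2 := Real.mul_self_sqrt (by norm_num)
          linear_combination (Λ * C * Pc ^ 2 * u) / 2 * this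
      _ ≤ Real.sqrt 2 * (Real.sqrt a * (r / (2 * (1 + ε₀) ^ ((K - 1 : ℤ) : ℝ) * w (K - 1)))) +
            C * τ * (ϑ / (1 + ε₀) ^ ((5 : ℝ) / 2)) * ν (K - 1) ^ 2 * (r / w (K - 1)) := by
          rw [hsqrtE]
          gcongr
      _ = (Real.sqrt 2 * Real.sqrt a / (2 * (1 + ε₀) ^ ((K - 1 : ℤ) : ℝ)) +
            C * τ * (ϑ / (1 + ε₀) ^ ((5 : ℝ) / 2)) * ν (K - 1) ^ 2) * (r / w (K - 1)) := by
          field_simp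
  have hinner0 : 0 ≤ Real.sqrt 2 * (Real.sqrt E₀ + Real.sqrt 2 / 2 * Λ * C * Pc ^ 2 * u) := by
    have := hu.1; positivity
  have hmain : Real.sqrt 2 * Real.sqrt (∑ i, F i K u) ≤ ν K * (r / w (K - 1)) := by
    calc Real.sqrt 2 * Real.sqrt (∑ i, F i K u)
        ≤ Real.sqrt 2 * ((Real.sqrt E₀ + Real.sqrt 2 / 2 * Λ * C * Pc ^ 2 * u) *
            Real.exp (Λ * C * Pc * u)) := mul_le_mul_of_nonneg_left hstep hs2
      _ = Real.sqrt 2 * (Real.sqrt E₀ + Real.sqrt 2 / 2 * Λ * C * Pc ^ 2 * u) *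
            Real.exp (Λ * C * Pc * u) := by ring
      _ ≤ ((Real.sqrt 2 * Real.sqrt a / (2 * (1 + ε₀) ^ ((K - 1 : ℤ) : ℝ)) +
            C * τ * (ϑ / (1 + ε₀) ^ ((5 : ℝ) / 2)) * ν (K - 1) ^ 2) * (r / w (K - 1))) * 2 :=
          mul_le_mul hinner hexp (Real.exp_pos _).le (hinner0.trans hinner)
      _ = 2 * (Real.sqrt 2 * Real.sqrt a / (2 * (1 + ε₀) ^ ((K - 1 : ℤ) : ℝ)) +
            C * τ * (ϑ / (1 + ε₀) ^ ((5 : ℝ) / 2)) * ν (K - 1) ^ 2) * (r / w (K - 1)) := by ring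
      _ ≤ ν K * (r / w (K - 1)) := mul_le_mul_of_nonneg_right hcl hrw1
  -- square
  have hF0 : 0 ≤ ∑ i, F i K u := Finset.sum_nonneg fun i _ => h.nonneg_F i K u hu
  have hsq : 2 * ∑ i, F i K u ≤ (ν K * (r / w (K - 1))) ^ 2 := by
    have h1 : 0 ≤ Real.sqrt 2 * Real.sqrt (∑ i, F i K u) := by positivity
    have h2 := pow_le_pow_left₀ h1 hmain 2
    rw [mul_pow, Real.sq_sqrt (by norm_num), Real.sq_sqrt hF0] at h2
    exact h2
  have : (ν K * (r / w (K - 1))) ^ 2 = (ν K * r / w (K - 1)) ^ 2 := by ring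
  rw [this] at hsq
  linarith

end GappedFrontRobustOn

end Summit.NavierStokesRegularity.NavierStokesRegularity.Theorems

end
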